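import Mathlib
import HarnessLib

/-!
# Two-point Liouville correlations averaged over PRIME lags at natural scale (Tao–Teräväinen 2019, from Tao 2016 + Matomäki–Radziwiłł)

## What is printed

Tao–Teräväinen, *The structure of correlations of multiplicative functions at almost all scales,
with applications to the Chowla and Elliott conjectures*, Algebra & Number Theory 13 (2019)
2103–2150 (arXiv:1809.02518), end of §5 (proof of Thm 1.17), p. 26 of the arXiv text, read at
page level (`lit read arxiv:1809.02518`, 2026-08-17), verbatim:

> "it suffices to show that  limsup_{X → ∞} | E_{P ≤ p < 2P} E_{n ≤ X/P} λ(n) λ(n+ph) | ≪ ε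
> for sufficiently large P. But this follows from the results in [Tao, Forum Math. Pi 4 (2016)],
> specifically Lemmas 3.6, 3.7 and equation (2.9) of that paper [footnote: the length of the sum
> over j ∈ [1,H] and the range 𝒫_H of primes p do not need to be controlled by the same parameter
> H] (see also Remark 3.8 for a simplification in the case of the Liouville function). We remark
> that the equation relies crucially on the Matomäki–Radziwiłł theorem (as applied in [MRT])."

Here `h ≥ 1` is a fixed shift, `p` ranges over primes, `E` denotes plain (natural-density)
averages, and the implied constant is absolute once `P ≥ P₀(h, ε)`.

## How it is rendered here (D-0014)

`E_{P ≤ p < 2P}` becomes the average over `(Finset.Ico P (2P)).filter Nat.Prime`, `E_{n ≤ N}` the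
average over `Finset.Icc 1 N` (the printed `N = X/P` runs through all large integers as `X` does,
so we quantify over `N` directly), "limsup ≪ ε for P large" becomes
`∀ ε > 0, ∃ P₀, ∀ P ≥ P₀, ∃ N₀, ∀ N ≥ N₀, |Σ_p Σ_n λ(n)λ(n+ph)| ≤ ε · N · #{p}` (the absolute
constant absorbed into `ε`). NOTE THE SHAPE: the absolute value sits OUTSIDE the sum over primes
(a signed average over `p`), exactly as printed. The route item this fact grounds,
`Summit.Parity.GeneralizedHardyLittlewood.Theses.EntropyRate.PrimeLagChowla`
(stmt-Parity-17878), puts the absolute value INSIDE the sum over `p` (an `L¹` average over prime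
lags) and is therefore formally STRONGER than this printed statement; the same circle-method /
restriction-theorem argument plausibly yields it (bounded twists `θ_p` of the coefficients
`c_p/p` are allowed by the restriction theorem for the primes), but that is not printed and is
left to the prover of the item. Users take `(h : taoTeravainen2019_primeLag_liouville)`.
-/

open Filter Finset

namespace Literature.NumberTheory.Sieve

/-- **Tao–Teräväinen 2019, §5 (p. 26), from Tao 2016 Lemmas 3.6–3.7 & (2.9) and
Matomäki–Radziwiłł (named fact): prime-lag averaged two-point Chowla for `λ` at natural scale.**
For every shift `h ≥ 1` and every `ε > 0` there is `P₀` such that for every `P ≥ P₀` there is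
`N₀` with: for all `N ≥ N₀`,
`|Σ_{p prime, P ≤ p < 2P} Σ_{1 ≤ n ≤ N} λ(n) λ(n + p h)| ≤ ε · N · #{p prime : P ≤ p < 2P}` —
i.e. `limsup_{N} |E_{P ≤ p < 2P} E_{n ≤ N} λ(n)λ(n+ph)| ≪ ε` for `P` large, verbatim the display
on p. 26 of arXiv:1809.02518 (signed average over `p`; absolute value outside). Grounds
`Summit.Parity.GeneralizedHardyLittlewood.Theses.EntropyRate.PrimeLagChowla` (stmt-Parity-17878),
which is the STRONGER `L¹`-over-primes form (absolute values inside the `p`-sum) — see the module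
docstring. [cite: TaoTeravainen2018, §5, p. 26 (proof of Thm. 1.17), via Tao FMP 2016 Lemmas 3.6, 3.7, eq. (2.9)] -/
def taoTeravainen2019_primeLag_liouville : Prop :=
  ∀ h : ℕ, 1 ≤ h → ∀ ε : ℝ, 0 < ε → ∃ P₀ : ℕ, ∀ P : ℕ, P₀ ≤ P → ∃ N₀ : ℕ, ∀ N : ℕ, N₀ ≤ N →
    |∑ p ∈ (Finset.Ico P (2 * P)).filter Nat.Prime, ∑ n ∈ Finset.Icc 1 N,
        (((ArithmeticFunction.liouville n * ArithmeticFunction.liouville (n + p * h) : ℤ)) : ℝ)|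
      ≤ ε * N * (((Finset.Ico P (2 * P)).filter Nat.Prime).card : ℝ)

/-- Sanity link (PROVED): the route item's `L¹`-over-primes form implies the printed signed form
(triangle inequality), so vendoring the printed statement loses nothing the route could use in the
converse direction; the item remains the stronger claim. [folklore] -/
theorem taoTeravainen2019_primeLag_liouville_of_l1
    (hL1 : ∀ h : ℕ, 1 ≤ h → ∀ ε : ℝ, 0 < ε → ∃ P₀ : ℕ, ∀ P : ℕ, P₀ ≤ P → ∃ N₀ : ℕ, ∀ N : ℕ,
      N₀ ≤ N → ∑ p ∈ (Finset.Ico P (2 * P)).filter Nat.Prime, |∑ n ∈ Finset.Icc 1 N,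
        (((ArithmeticFunction.liouville n * ArithmeticFunction.liouville (n + p * h) : ℤ)) : ℝ)|
      ≤ ε * N * (((Finset.Ico P (2 * P)).filter Nat.Prime).card : ℝ)) :
    taoTeravainen2019_primeLag_liouville := by
  intro h hh ε hε
  obtain ⟨P₀, hP₀⟩ := hL1 h hh ε hε
  refine ⟨P₀, fun P hP => ?_⟩
  obtain ⟨N₀, hN₀⟩ := hP₀ P hP
  refine ⟨N₀, fun N hN => ?_⟩
  exact (Finset.abs_sum_le_sum_abs _ _).trans (hN₀ N hN)

end Literature.NumberTheory.Sieve
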